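import Summits.CriticalPhenomena.PercolationContinuityZ3.Theorems.SoloInformedLinkedEvents
import HarnessLib

/-!
# The box-crossing window at `p_c`: an a-priori lower bound (solo seat
`solo-CriticalPhenomena-informed`, paper §7b.3 (d5), the other side of row (Y))

Row (Y) of the portrait (`percolationContinuityZ3_of_frequently_annulusCrossing_le`,
`percolationContinuity_iff_boxCrossing`) says that `θ(p_c) = 0` on `ℤ^d` is *equivalent* to an
RSW-type **upper** bound: the crossing probabilities `P_{p_c}(Λ(n) ↔ ∂ⁱⁿΛ(N) in Λ(N))` stay
below `1 - δ` along some sequence of annuli.  This file proves, unconditionally and in every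
dimension `d ≥ 2`, the complementary **lower** bound: writing
`u_p(L) = P_p(boxCrossing d L (4L)) = P_p(Λ(L) ↔ ∂ⁱⁿΛ(4L) in Λ(4L))`,

* `real_boxCrossing_four_mul_le` — the scale recursion `u_p(4L) ≤ 85^d · u_p(L)²` (`L ≥ 1`);
* `theta_eq_zero_of_crossProb_lt` — the finite-size criterion: `85^d · u_p(L) < 1` for one
  `L ≥ 1` forces `θ(p) = 0`;
* `le_crossProb_criticalProbI` — hence **`P_{p_c}(Λ(L) ↔ ∂ⁱⁿΛ(4L) in Λ(4L)) ≥ 85^{-d}` for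
  every `L ≥ 1`** (`d ≥ 2`), and (`le_real_boxCrossing_two_mul_criticalProbI`)
  `P_{p_c}(Λ(2L) ↔ ∂ⁱⁿΛ(4L) in Λ(4L)) ≥ 85^{-d}`: at criticality the annulus-crossing
  probabilities of row (Y) live in the window `[85^{-d}, 1]` at all scales, and by row (Y) the
  conjunct `PercolationContinuityZ3` FOLLOWS as soon as they do not converge to the upper end `1`
  (`boxCrossing_window_Z3`).

The recursion is proved without the BK inequality: an open path from `Λ(4L)` to `∂ⁱⁿΛ(16L)`
starts in a block `Λ_x(L) = x + Λ(L)` of the grid `x ∈ (2L+1)ℤ^d` with `‖x‖∞ ≤ 5L` and ends in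
a block `Λ_y(L)` with `‖y‖∞ ≥ 15L`; its initial segment realises the translate
`Λ_x(L) ↔ ∂ⁱⁿΛ_x(4L) in Λ_x(4L)` and its final segment, read backwards, the translate at `y`.
The two translated events are determined by the edges of the disjoint boxes `Λ_x(4L) ⊆ Λ(9L)`
and `Λ_y(4L) ⊆ ℤ^d \ Λ(10L)`, hence independent, and there are at most `5^d · 17^d` pairs
`(x, y)`.  Iterating, `85^d u_p(4^j L) ≤ (85^d u_p(L))^{2^j}`, while `θ(p) ≤ u_p(n)` for every
`n` (`{0 ↔ ∞} ⊆ {Λ(n) ↔ ∞} ⊆ boxCrossing d n (4n)` a.s.); so `85^d u_p(L) < 1` gives `θ(p) = 0`.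
Since `u_p(L)` is a polynomial in `p` and `θ > 0` on `(p_c, 1]`, the strict inequality cannot
hold at `p_c`.

This is the classical a-priori bound of Kesten (sponge-crossing form: Kesten 1982, Thm. 5.1 and
Cor. 5.1, where short-way crossings of `(3N) × ⋯ × N × ⋯ × (3N)` blocks below a universal
constant force exponential decay, so that at the critical point they stay above it), restated for
the annulus events of row (Y) and with `p_H` in place of `p_T`; the elementary independence
bootstrap replaces Kesten's counting of block sequences. [cite: Kesten1982, Thm. 5.1, Cor. 5.1]

Placement (paper §7b.3 (d5)).  Together with row (Y) this exhibits a sufficient condition for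
the target as a statement about a bounded, scale-indexed sequence confined to `[85^{-d}, 1]`:
`θ(p_c) = 0` follows if the sequence does not tend to `1`.  The converse is false as a statement
about all `d`: the lower bound holds in every dimension, including `d ≥ 11`, where `θ(p_c) = 0`
is a theorem and the crossing probabilities nevertheless DO tend to `1` (above six dimensions
boxes are crossed by many spanning clusters: Kozma–Nachmias one-arm estimate and the `|x|^{2-d}`
two-point function); so the missing upper bound is dimension-specific (hyperscaling)
information and cannot come from a scale recursion of the present kind, whose ingredients are
dimension-free.
-/

noncomputable section

namespace Summit.CriticalPhenomena.PercolationContinuityZ3.Theorems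

open MeasureTheory ProbabilityTheory Filter Topology
open Literature.Probability.Percolation Literature.Probability.LatticeModels
open Literature.Probability.Percolation.CerfDembinVanishing
open scoped ENNReal

namespace SurfaceTension

variable {d : ℕ}

/-! ## The index pairs of the covering -/

open scoped Classical in
/-- The index pairs of the covering: grid indices `k₁ ∈ Λ(2)`, `k₂ ∈ Λ(8)` whose blocks
`Λ_{(2L+1)k₁}(4L)`, `Λ_{(2L+1)k₂}(4L)` are far apart in some coordinate. -/
def farPairs (d L : ℕ) : Finset (Site d × Site d) :=
  ((box d 2) ×ˢ (box d 8)).filter fun kk =>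
    ∃ i, 8 * (L : ℤ) < |gridPt L kk.2 i - gridPt L kk.1 i|

/-- There are at most `85^d` index pairs. -/
theorem card_farPairs_le (d L : ℕ) : (farPairs d L).card ≤ 85 ^ d := by
  classical
  calc (farPairs d L).card ≤ ((box d 2) ×ˢ (box d 8)).card := Finset.card_filter_le _ _
    _ = 85 ^ d := by
        rw [Finset.card_product, card_box, card_box, ← mul_pow]
        norm_num

/-- Far-apart blocks are disjoint. -/
theorem disjoint_sbox_of_far {L : ℕ} {v₁ v₂ : Site d} (h : ∃ i, 8 * (L : ℤ) < |v₂ i - v₁ i|) :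
    Disjoint (sbox v₁ (4 * L)) (sbox v₂ (4 * L)) := by
  rw [Set.disjoint_left]
  intro y h₁ h₂
  obtain ⟨i, hi⟩ := h
  have h₁i := (mem_sbox_iff.1 h₁) i
  have h₂i := (mem_sbox_iff.1 h₂) i
  push_cast at h₁i h₂i
  have habs : |v₂ i - v₁ i| ≤ 8 * (L : ℤ) := abs_le.2 ⟨by linarith, by linarith⟩
  linarith

/-- Membership in `farPairs`, unfolded. -/
theorem mem_farPairs_iff {L : ℕ} {kk : Site d × Site d} :
    kk ∈ farPairs d L ↔ (kk.1 ∈ box d 2 ∧ kk.2 ∈ box d 8) ∧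
      ∃ i, 8 * (L : ℤ) < |gridPt L kk.2 i - gridPt L kk.1 i| := by
  classical
  rw [farPairs, Finset.mem_filter, Finset.mem_product]

/-! ## The covering and the scale recursion -/

/-- **Geometric covering.** An open crossing from `Λ(4L)` to `∂ⁱⁿΛ(16L)` realises two translated
crossings at scale `L` in far-apart blocks: one at the grid block of its starting point
(`‖x‖∞ ≤ 5L`) and one at the grid block of its endpoint (`‖y‖∞ ≥ 15L`). -/
theorem boxCrossing_subset_biUnion_sCross {L : ℕ} (hL : 1 ≤ L) :
    boxCrossing d (4 * L) (4 * (4 * L)) ⊆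
      ⋃ kk ∈ farPairs d L, (sCross L (gridPt L kk.1) ∩ sCross L (gridPt L kk.2)) := by
  intro ω hω
  rw [boxCrossing_eq_linked, mem_linked_iff] at hω
  obtain ⟨b, hb, a, ha, hab⟩ := hω
  rw [Finset.mem_coe] at ha hb
  have hbB : b ∈ box d (4 * (4 * L)) := (mem_innerBoundary_iff.1 hb).1
  obtain ⟨i, hi⟩ := exists_eq_of_mem_innerBoundary_box hb
  -- the open path, as reachability by open lattice edges
  have hreach : (openGraph ω ⊓ zdGraph d).Reachable a b := by
    rw [inConn_comm, mem_inConn_iff] at hab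
    exact hab.mono (inf_le_inf_left _ (withinGraph_le _ _))
  -- the two grid blocks
  set k₁ := gridIdx L a with hk₁def
  set k₂ := gridIdx L b with hk₂def
  have hk₁ : k₁ ∈ box d 2 := gridIdx_mem_box (M := 4 * L) (K := 2) (by push_cast; omega) ha
  have hk₂ : k₂ ∈ box d 8 :=
    gridIdx_mem_box (M := 4 * (4 * L)) (K := 8) (by push_cast; omega) hbB
  have ha₁ : a ∈ sbox (gridPt L k₁) L := mem_sbox_gridPt L a
  have hb₂ : b ∈ sbox (gridPt L k₂) L := mem_sbox_gridPt L b
  have ha₁i := gridPt_gridIdx_sub_le L a i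
  have hb₂i := gridPt_gridIdx_sub_le L b i
  rw [← hk₁def] at ha₁i
  rw [← hk₂def] at hb₂i
  have hai := (mem_box.1 ha) i
  push_cast at hai hi
  -- the blocks are far apart in coordinate `i`
  have hfar : ∃ j, 8 * (L : ℤ) < |gridPt L k₂ j - gridPt L k₁ j| := by
    refine ⟨i, ?_⟩
    rcases hi with hi | hi
    · rw [hi] at hb₂i
      exact lt_of_lt_of_le (by linarith) (le_abs_self _)
    · rw [hi] at hb₂i
      exact lt_of_lt_of_le (by linarith) (neg_le_abs _)
  have hmem : (k₁, k₂) ∈ farPairs d L := mem_farPairs_iff.2 ⟨⟨hk₁, hk₂⟩, hfar⟩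
  -- the endpoint is outside the first block, the starting point outside the second
  have hb₁ : b ∉ sbox (gridPt L k₁) (4 * L) := by
    intro h
    have h' := (mem_sbox_iff.1 h) i
    push_cast at h'
    rcases hi with hi | hi <;> rw [hi] at h' <;> [linarith [h'.2]; linarith [h'.1]]
  have ha₂ : a ∉ sbox (gridPt L k₂) (4 * L) := by
    intro h
    have h' := (mem_sbox_iff.1 h) i
    push_cast at h'
    rcases hi with hi | hi <;> rw [hi] at hb₂i <;> [linarith [h'.1]; linarith [h'.2]]
  refine Set.mem_iUnion₂.2 ⟨(k₁, k₂), hmem, ?_, ?_⟩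
  · exact mem_sCross_of_reachable ha₁ hb₁ hreach
  · exact mem_sCross_of_reachable hb₂ ha₂ hreach.symm

/-- `u_p(L) = P_p(Λ(L) ↔ ∂ⁱⁿΛ(4L) in Λ(4L))`, the crossing probability of row (Y) at aspect
ratio `4`. -/
def crossProb (d : ℕ) (p : unitInterval) (L : ℕ) : ℝ :=
  (bondPercolation (zdGraph d) p).real (boxCrossing d L (4 * L))

/-- `0 ≤ u_p(L)`. -/
theorem crossProb_nonneg (p : unitInterval) (L : ℕ) : 0 ≤ crossProb d p L := measureReal_nonneg

/-- **Scale recursion** `u_p(4L) ≤ 85^d · u_p(L)²` (`L ≥ 1`). -/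
theorem real_boxCrossing_four_mul_le (p : unitInterval) {L : ℕ} (hL : 1 ≤ L) :
    crossProb d p (4 * L) ≤ 85 ^ d * crossProb d p L ^ 2 := by
  have hsum : (bondPercolation (zdGraph d) p).real
        (⋃ kk ∈ farPairs d L, (sCross L (gridPt L kk.1) ∩ sCross L (gridPt L kk.2))) ≤
      ∑ kk ∈ farPairs d L, (bondPercolation (zdGraph d) p).real
        (sCross L (gridPt L kk.1) ∩ sCross L (gridPt L kk.2)) :=
    measureReal_biUnion_finset_le _ _
  have hterm : ∀ kk ∈ farPairs d L, (bondPercolation (zdGraph d) p).real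
      (sCross L (gridPt L kk.1) ∩ sCross L (gridPt L kk.2)) = crossProb d p L ^ 2 := by
    intro kk hkk
    rw [real_inter_sCross p (disjoint_sbox_of_far (mem_farPairs_iff.1 hkk).2), real_sCross,
      real_sCross, crossProb, sq]
  calc crossProb d p (4 * L)
      ≤ (bondPercolation (zdGraph d) p).real
          (⋃ kk ∈ farPairs d L, (sCross L (gridPt L kk.1) ∩ sCross L (gridPt L kk.2))) :=
        measureReal_mono (boxCrossing_subset_biUnion_sCross hL) (measure_ne_top _ _)
    _ ≤ ∑ kk ∈ farPairs d L, crossProb d p L ^ 2 := hsum.trans (Finset.sum_congr rfl hterm).le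
    _ = (farPairs d L).card * crossProb d p L ^ 2 := by rw [Finset.sum_const, nsmul_eq_mul]
    _ ≤ 85 ^ d * crossProb d p L ^ 2 := by
        gcongr
        exact_mod_cast card_farPairs_le d L

/-- Iterated recursion: `85^d u_p(4^j L) ≤ (85^d u_p(L))^{2^j}`. -/
theorem crossProb_iter_le (p : unitInterval) {L : ℕ} (hL : 1 ≤ L) (j : ℕ) :
    85 ^ d * crossProb d p (4 ^ j * L) ≤ (85 ^ d * crossProb d p L) ^ (2 ^ j) := by
  induction j with
  | zero => simp
  | succ j ih =>
    have hLj : 1 ≤ 4 ^ j * L := Nat.le_of_lt_succ (by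
      have := Nat.one_le_pow j 4 (by norm_num); nlinarith)
    have hrec := real_boxCrossing_four_mul_le (d := d) p hLj
    have h0 : 0 ≤ 85 ^ d * crossProb d p (4 ^ j * L) := by
      have := crossProb_nonneg (d := d) p (4 ^ j * L); positivity
    calc 85 ^ d * crossProb d p (4 ^ (j + 1) * L)
        = 85 ^ d * crossProb d p (4 * (4 ^ j * L)) := by rw [pow_succ, mul_comm (4 ^ j) 4, mul_assoc]
      _ ≤ 85 ^ d * (85 ^ d * crossProb d p (4 ^ j * L) ^ 2) := by gcongr
      _ = (85 ^ d * crossProb d p (4 ^ j * L)) ^ 2 := by ring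
      _ ≤ ((85 ^ d * crossProb d p L) ^ (2 ^ j)) ^ 2 := pow_le_pow_left₀ h0 ih 2
      _ = (85 ^ d * crossProb d p L) ^ (2 ^ (j + 1)) := by rw [← pow_mul, pow_succ]

/-- `θ(p) ≤ u_p(n)`: the origin's infinite cluster crosses every annulus around it. -/
theorem theta_le_crossProb (p : unitInterval) (n : ℕ) : theta (zdGraph d) 0 p ≤ crossProb d p n := by
  have h1 : (percolatesAt (0 : Site d) : Set (BondConfig (Site d))) ⊆ boxToInfinity d n :=
    fun ω hω => ⟨0, zero_mem_box d n, hω⟩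
  calc theta (zdGraph d) 0 p = (bondPercolation (zdGraph d) p).real (percolatesAt (0 : Site d)) := rfl
    _ ≤ (bondPercolation (zdGraph d) p).real (boxToInfinity d n) := measureReal_mono h1
    _ ≤ crossProb d p n := real_boxToInfinity_le_real_boxCrossing p (by omega)

/-- **Finite-size criterion.** If `85^d · u_p(L) < 1` for some `L ≥ 1` then `θ(p) = 0`.
[cite: Kesten1982, Thm. 5.1] -/
theorem theta_eq_zero_of_crossProb_lt (p : unitInterval) {L : ℕ} (hL : 1 ≤ L)
    (h : 85 ^ d * crossProb d p L < 1) : theta (zdGraph d) 0 p = 0 := by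
  set a : ℝ := 85 ^ d * crossProb d p L with ha
  have ha0 : 0 ≤ a := by have := crossProb_nonneg (d := d) p L; positivity
  have hpow : Tendsto (fun j : ℕ => a ^ (2 ^ j)) atTop (𝓝 0) :=
    (tendsto_pow_atTop_nhds_zero_of_lt_one ha0 h).comp
      (tendsto_pow_atTop_atTop_of_one_lt one_lt_two)
  have hθ : ∀ j : ℕ, 85 ^ d * theta (zdGraph d) 0 p ≤ a ^ (2 ^ j) := fun j =>
    (mul_le_mul_of_nonneg_left (theta_le_crossProb p (4 ^ j * L)) (by positivity)).trans
      (crossProb_iter_le p hL j)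
  have hle : 85 ^ d * theta (zdGraph d) 0 p ≤ 0 := ge_of_tendsto' hpow hθ
  have hθ0 : 0 ≤ theta (zdGraph d) 0 p := measureReal_nonneg
  have h85 : (0 : ℝ) < 85 ^ d := by positivity
  nlinarith

/-- **The a-priori lower bound at `p_c`** (`d ≥ 2`): `85^{-d} ≤ P_{p_c}(Λ(L) ↔ ∂ⁱⁿΛ(4L) in Λ(4L))`
for every `L ≥ 1`.  (`u_p(L)` is continuous in `p` and `θ > 0` on `(p_c, 1]`, where the
finite-size criterion therefore fails.) [cite: Kesten1982, Cor. 5.1] -/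
theorem le_crossProb_criticalProbI (hd : 2 ≤ d) {L : ℕ} (hL : 1 ≤ L) :
    ((85 : ℝ) ^ d)⁻¹ ≤ crossProb d (criticalProbI d) L := by
  by_contra hlt
  push Not at hlt
  have h85 : (0 : ℝ) < 85 ^ d := by positivity
  have h1 : 85 ^ d * crossProb d (criticalProbI d) L < 1 := by
    have := mul_lt_mul_of_pos_left hlt h85
    rwa [mul_inv_cancel₀ h85.ne'] at this
  -- continuity of `p ↦ 85^d u_p(L)` at `p_c`
  have hcont : Continuous fun p : unitInterval => 85 ^ d * crossProb d p L :=
    continuous_const.mul (continuous_real_boxCrossing L (4 * L))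
  obtain ⟨δ, hδ, hball⟩ := Metric.continuous_iff.1 hcont (criticalProbI d)
    (1 - 85 ^ d * crossProb d (criticalProbI d) L) (by linarith)
  -- a parameter slightly above `p_c`
  have hpc1 : criticalProb (zdGraph d) (0 : Site d) < 1 := criticalProb_zd_lt_one hd
  have hpc0 : 0 ≤ criticalProb (zdGraph d) (0 : Site d) := (criticalProb_mem_Icc _ _).1
  set t : ℝ := min (criticalProb (zdGraph d) (0 : Site d) + δ / 2) 1 with ht
  have htI : t ∈ Set.Icc (0 : ℝ) 1 := ⟨le_min (by linarith) zero_le_one, min_le_right _ _⟩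
  obtain ⟨p, hp⟩ : ∃ p : unitInterval, (p : ℝ) = t := ⟨⟨t, htI⟩, rfl⟩
  have hlt' : criticalProb (zdGraph d) (0 : Site d) < (p : ℝ) := by
    rw [hp]; exact lt_min (by linarith) hpc1
  have hle' : (p : ℝ) ≤ criticalProb (zdGraph d) (0 : Site d) + δ / 2 := by
    rw [hp]; exact min_le_left _ _
  have hdist : dist p (criticalProbI d) < δ := by
    rw [Subtype.dist_eq, Real.dist_eq, coe_criticalProbI, abs_of_pos (sub_pos.2 hlt')]
    linarith
  have hnear := hball p hdist
  rw [Real.dist_eq] at hnear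
  have hp1 : 85 ^ d * crossProb d p L < 1 := by
    have := (abs_sub_lt_iff.1 hnear).1
    linarith
  have hθ0 := theta_eq_zero_of_crossProb_lt p hL hp1
  have hθpos := theta_pos_of_criticalProb_lt_holds (zdGraph d) 0 p hlt'
  linarith

/-- The same bound for the events of row (Y) (`Λ(2L) ↔ ∂ⁱⁿΛ(4L)`, aspect ratio `2`):
`85^{-d} ≤ P_{p_c}(boxCrossing d (2L) (4L))` for all `L ≥ 1`, `d ≥ 2`.  Row (Y) asks for these
probabilities to stay `≤ 1 - δ` infinitely often; unconditionally they stay `≥ 85^{-d}`. -/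
theorem le_real_boxCrossing_two_mul_criticalProbI (hd : 2 ≤ d) {L : ℕ} (hL : 1 ≤ L) :
    ((85 : ℝ) ^ d)⁻¹ ≤
      (bondPercolation (zdGraph d) (criticalProbI d)).real (boxCrossing d (2 * L) (2 * (2 * L))) := by
  refine (le_crossProb_criticalProbI hd hL).trans ?_
  rw [crossProb, show 2 * (2 * L) = 4 * L by ring]
  exact measureReal_mono (boxCrossing_mono_left (by omega) _)

/-- **Row (Y), two-sided, `d = 3`.**  Unconditionally `P_{p_c(ℤ³)}(Λ(2L) ↔ ∂ⁱⁿΛ(4L) in Λ(4L))`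
lies in `[85^{-3}, 1]` for every `L ≥ 1`, and the conjunct `PercolationContinuityZ3` follows if these
probabilities do not tend to `1` (row (Y)); with the outer scale free instead of `= 2 ·` inner scale
the second clause is an equivalence (`percolationContinuity_iff_boxCrossing`). -/
theorem boxCrossing_window_Z3 {L : ℕ} (hL : 1 ≤ L) :
    ((85 : ℝ) ^ 3)⁻¹ ≤
        (bondPercolation (zdGraph 3) (criticalProbI 3)).real (boxCrossing 3 (2 * L) (2 * (2 * L))) ∧
      ((∃ δ : ℝ, 0 < δ ∧ ∃ᶠ n : ℕ in atTop,
          (bondPercolation (zdGraph 3) (criticalProbI 3)).real (boxCrossing 3 n (2 * n)) ≤ 1 - δ) →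
        PercolationContinuityZ3) :=
  ⟨le_real_boxCrossing_two_mul_criticalProbI (by norm_num) hL,
    percolationContinuityZ3_of_frequently_annulusCrossing_le⟩

end SurfaceTension

end Summit.CriticalPhenomena.PercolationContinuityZ3.Theorems

end
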